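import Summits.PneNP.PneNP.Theorems.KrwChromaticSteeringStrongCompositionLradState

/-!
# Crux line `lrad-gluing` (stmt-PneNP-18538), the glued adversary II: collapse, leaves, label and affine steps

Steps of the gluing adversary for the invariant `InvAt` (potential `ℓ + min K k ≤ depth + 2`; closed skeleton
`Cruxes/StrongComposition/Lines/lrad_gluing.lean` §8, commit 5a5f8789ebd3):

* `collapseE` — PRIVATE COLLAPSE (any budget): label-exact private families of fibred matrices (S2) turn the
  subtree into a protocol of the same depth for the realisable label rectangle `AE A S × AE B T` (a violation is
  a pair with equal labels in the output row), so `ℓ ≤ depth`;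
* `inv_leafAt` — LEAF `(i, j)`: labels differ at `i` on the realisable rectangle (`ℓ = 0`); in an equation-free
  row M3's leaf argument through fibred realisation with row `i` prescribed (`K ≤ 2`); in a row carrying
  equations, with budget `k ≥ 1`, the pin `X_ij = c` joins the common system and realises a valid pair with
  EQUAL `(i, j)` entries — contradiction;
* `label_stepAt_alice/bob` — one-bit subadditivity (`ℓ − 1`), everything else kept;
* `affine_stepAt_alice/bob` — with `k ≥ 1` the `E`-consistent answer joins the COMMON system for both players
  (`k − 1`; label sets, row sets, `AE`, `Alive`, `cst` unchanged); with `k = 0`, collapse.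

FRONTIER rung of the KRW programme; nothing here bears on P vs NP.
-/

set_option linter.dupNamespace false -- `Summit.PneNP.PneNP.…`: summit = sub-problem name (D-0017 single-conjunct layout)
set_option autoImplicit false

namespace Summit.PneNP.PneNP.Theorems.KrwLrad

open Literature.Computability.Complexity

universe u

section Steps

variable {m n : ℕ} {g : (Fin n → Bool) → Bool} {q : ℕ}

/-- **Private collapse** (`k = 0`, and in fact at any time): label-exact PRIVATE families of fibred
matrices (S2) turn the subtree into a protocol of the same depth for the realisable label rectangle
(violation = equal labels in the output row), so `ℓ ≤ depth`. -/
theorem collapseE (hLU : PerRowLU g m q) {τ : Fin m → RowType} {A B : Set (Fin m → Bool)}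
    {S T : Fin m → Set (Fin n → Bool)} {E : AffSys m n} (hst : StateOK τ S T E) (hsat : ∃ X, Sat E X)
    (hload : ∀ i, rowLoad E i ≤ q) {P : KWTree (Fin m × Fin n)} (hV : ValidOnE g P A B S T E)
    {ℓ : ℕ} (hH : Hard (AE g A S) (AE g B T) ℓ) : ℓ ≤ P.depth := by
  classical
  have hA : ∀ a, a ∈ AE g A S → ∃ X ∈ XSetE g A S E, rowLabels g X = a :=
    fun a ha => exists_XE hLU hload hsat hst.typed_left ha
  have hB : ∀ b, b ∈ AE g B T → ∃ Y ∈ XSetE g B T E, rowLabels g Y = b :=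
    fun b hb => exists_XE hLU hload hsat hst.typed_right hb
  let FA : (Fin m → Bool) → (Fin m × Fin n → Bool) := fun a =>
    if h : a ∈ AE g A S then (hA a h).choose else fun _ => false
  let FB : (Fin m → Bool) → (Fin m × Fin n → Bool) := fun b =>
    if h : b ∈ AE g B T then (hB b h).choose else fun _ => false
  have hFA : ∀ a, a ∈ AE g A S → FA a ∈ XSetE g A S E ∧ rowLabels g (FA a) = a := by
    intro a h
    have := (hA a h).choose_spec
    simp only [FA, dif_pos h]
    exact this
  have hFB : ∀ b, b ∈ AE g B T → FB b ∈ XSetE g B T E ∧ rowLabels g (FB b) = b := by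
    intro b h
    have := (hB b h).choose_spec
    simp only [FB, dif_pos h]
    exact this
  have hsol : SolvesRect (P.comap FA FB Prod.fst) (AE g A S) (AE g B T) := by
    intro a ha b hb
    rw [KWTree.run_comap]
    obtain ⟨hXa, hla⟩ := hFA a ha
    obtain ⟨hYb, hlb⟩ := hFB b hb
    have h2 := (hV _ hXa _ hYb).2
    rw [hla, hlb] at h2
    exact h2
  have := hH _ hsol
  rwa [KWTree.depth_comap] at this

/-- **LEAF** `(i, j)`.  Labels differ at `i` on the realisable rectangle, so `ℓ = 0`.  If row `i` carries
no equation, M3's argument: the row game of the output orientation is solved by the leaf `j` (fibred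
realisation with row `i` prescribed), so `K ≤ 2`.  If row `i` carries equations (so both row-sets are
`univ`) and `k ≥ 1`, the pin `X_{ij} = c` joins `E` and a valid pair with equal `(i, j)` entries exists:
contradiction.  With `k = 0` the bound is `0 ≤ 2`. -/
theorem inv_leafAt (hLU : PerRowLU g m q) (p : Fin m × Fin n) (τ : Fin m → RowType) :
    InvAt g q τ (KWTree.leaf p) := by
  classical
  intro A B S T E k hst hsat hload hV hD hneA hneB ℓ K r hL hR hK
  obtain ⟨i, j⟩ := p
  obtain ⟨a, ha⟩ := hneA
  obtain ⟨b, hb⟩ := hneB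
  have hloadq : ∀ i, rowLoad E i ≤ q := fun i => by have := hload i; omega
  have htS := hst.typed_left
  have htT := hst.typed_right
  -- labels differ at `i` on the whole realisable rectangle
  have hdiff : ∀ a ∈ AE g A S, ∀ b ∈ AE g B T, a i ≠ b i := by
    intro a ha b hb
    obtain ⟨X, hX, hXa⟩ := exists_XE hLU hloadq hsat htS ha
    obtain ⟨Y, hY, hYb⟩ := exists_XE hLU hloadq hsat htT hb
    have h2 := (hV X hX Y hY).2
    simp only [KWTree.run_leaf] at h2
    rw [hXa, hYb] at h2
    exact h2
  have hℓ : ℓ = 0 := hL.eq_zero_of_leaf (i := i) (fun a ha b hb => by simpa using hdiff a ha b hb)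
  cases k with
  | zero => simp [hℓ]
  | succ k =>
    by_cases hEi : rowLoad E i = 0
    · -- M3 leaf: the row game of the output orientation is solved by the leaf `j`
      have hab : b i = !(a i) := by
        have := hdiff a ha b hb
        cases hai : a i <;> cases hbi : b i <;> simp_all
      have halive : Alive g A B S T i (a i) := ⟨⟨a, ha, rfl⟩, ⟨b, hb, hab⟩⟩
      have hr : r i (a i) = 0 := by
        refine (hR i (a i) halive).eq_zero_of_leaf (i := j) ?_
        intro x hx y hy
        obtain ⟨X, hX, -, hXi⟩ := exists_XE_row hLU hloadq hsat htS ha hEi hx.1 hx.2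
        obtain ⟨Y, hY, -, hYi⟩ := exists_XE_row hLU hloadq hsat htT hb hEi hy.1 (hy.2.trans hab.symm)
        have h1 := (hV X hX Y hY).1
        simp only [KWTree.run_leaf] at h1
        have hx' : X (i, j) = x j := by rw [← hXi]; rfl
        have hy' : Y (i, j) = y j := by rw [← hYi]; rfl
        simpa [hx', hy'] using h1
      have hk := hK i (a i) halive
      have h1 := cst_le_one (AE g A S) i
      have h2 := cst_le_one (AE g B T) i
      simp only [KWTree.depth_leaf]
      omega
    · -- algebraic leaf: pin the entry `(i, j)` for both players
      exfalso
      have hτi : τ i = RowType.algebraic := by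
        by_contra hne
        exact hEi ((hst i).1 hne)
      obtain ⟨X₀, hX₀⟩ := hsat
      set E' : AffSys m n := (({(i, j)}, X₀ (i, j)) :: E) with hE'
      have hst' : StateOK τ S T E' := hst.pin_cons (p := (i, j)) hτi (X₀ (i, j))
      have hsat' : ∃ X, Sat E' X := ⟨X₀, fun e he => by
        rcases List.mem_cons.1 he with rfl | he
        · simp
        · exact hX₀ e he⟩
      have hload' : ∀ i', rowLoad E' i' ≤ q := fun i' => by
        have h1 := rowLoad_cons_le ({(i, j)}, X₀ (i, j)) E i'
        have h2 := hload i'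
        rw [hE']
        omega
      obtain ⟨X, hX, -⟩ := exists_XE hLU hload' hsat' hst'.typed_left ha
      obtain ⟨Y, hY, -⟩ := exists_XE hLU hload' hsat' hst'.typed_right hb
      rw [hE', XSetE_cons] at hX hY
      have hXp : X (i, j) = X₀ (i, j) := by simpa using hX.2
      have hYp : Y (i, j) = X₀ (i, j) := by simpa using hY.2
      have h1 := (hV X hX.1 Y hY.1).1
      simp only [KWTree.run_leaf] at h1
      exact h1 (hXp.trans hYp.symm)

/-- ALICE LABEL TEST: `ℓ` drops by at most one (subadditivity); everything else is kept. -/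
theorem label_stepAt_alice (i₀ : Fin m) {τ : Fin m → RowType} {s : (Fin m × Fin n → Bool) → Bool}
    {P Q : KWTree (Fin m × Fin n)} {φ : (Fin m → Bool) → Bool} (hφ : ∀ X, s X = φ (rowLabels g X))
    (hIP : InvAt g q τ P) (hIQ : InvAt g q τ Q) : InvAt g q τ (KWTree.alice s P Q) := by
  intro A B S T E k hst hsat hload hV hD hneA hneB ℓ K r hL hR hK
  obtain ⟨β, hne, hH⟩ := hL.split_alice hneA i₀ φ
  obtain ⟨C, hIC, hCd, hrun⟩ := alice_childAt (s := s) hIP hIQ β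
  set A' : Set (Fin m → Bool) := A ∩ {a | φ a = β} with hA'
  have hAE : AE g A' S = AE g A S ∩ {a | φ a = β} := AE_inter_label A S φ β
  have hsub : AE g A' S ⊆ AE g A S := by rw [hAE]; exact Set.inter_subset_left
  have hV' : ValidOnE g C A' B S T E := by
    intro X hX Y hY
    rw [hA', XSetE_inter_label] at hX
    have hsX : s X = β := by rw [hφ X]; exact hX.2
    have := hV X hX.1 Y hY
    rwa [hrun X Y hsX] at this
  have hD' : ∀ a ∈ AE g A' S, ∀ b ∈ AE g B T, a ≠ b := fun a ha b hb => hD a (hsub ha) b hb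
  have hneA' : (AE g A' S).Nonempty := by rw [hAE]; exact hne
  have hL' : Hard (AE g A' S) (AE g B T) (ℓ - 1) := by rw [hAE]; exact hH
  have hR' : ∀ i α, Alive g A' B S T i α → Hard (RA g S i α) (RA g T i (!α)) (r i α) :=
    fun i α h => hR i α (h.mono hsub fun _ hb => hb)
  have hK' : ∀ i α, Alive g A' B S T i α → K ≤ r i α + cst (AE g A' S) i + cst (AE g B T) i := by
    intro i α h
    have hk := hK i α (h.mono hsub fun _ hb => hb)
    have hc := cst_mono hsub i
    omega
  have := hIC A' B S T E k hst hsat hload hV' hD' hneA' hneB (ℓ - 1) K r hL' hR' hK'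
  simp only [KWTree.depth_alice]
  omega

/-- BOB LABEL TEST. -/
theorem label_stepAt_bob (i₀ : Fin m) {τ : Fin m → RowType} {s : (Fin m × Fin n → Bool) → Bool}
    {P Q : KWTree (Fin m × Fin n)} {φ : (Fin m → Bool) → Bool} (hφ : ∀ Y, s Y = φ (rowLabels g Y))
    (hIP : InvAt g q τ P) (hIQ : InvAt g q τ Q) : InvAt g q τ (KWTree.bob s P Q) := by
  intro A B S T E k hst hsat hload hV hD hneA hneB ℓ K r hL hR hK
  obtain ⟨β, hne, hH⟩ := hL.split_bob hneB i₀ φ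
  obtain ⟨C, hIC, hCd, hrun⟩ := bob_childAt (s := s) hIP hIQ β
  set B' : Set (Fin m → Bool) := B ∩ {b | φ b = β} with hB'
  have hAE : AE g B' T = AE g B T ∩ {b | φ b = β} := AE_inter_label B T φ β
  have hsub : AE g B' T ⊆ AE g B T := by rw [hAE]; exact Set.inter_subset_left
  have hV' : ValidOnE g C A B' S T E := by
    intro X hX Y hY
    rw [hB', XSetE_inter_label] at hY
    have hsY : s Y = β := by rw [hφ Y]; exact hY.2
    have := hV X hX Y hY.1
    rwa [hrun X Y hsY] at this
  have hD' : ∀ a ∈ AE g A S, ∀ b ∈ AE g B' T, a ≠ b := fun a ha b hb => hD a ha b (hsub hb)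
  have hneB' : (AE g B' T).Nonempty := by rw [hAE]; exact hne
  have hL' : Hard (AE g A S) (AE g B' T) (ℓ - 1) := by rw [hAE]; exact hH
  have hR' : ∀ i α, Alive g A B' S T i α → Hard (RA g S i α) (RA g T i (!α)) (r i α) :=
    fun i α h => hR i α (h.mono (fun _ ha => ha) hsub)
  have hK' : ∀ i α, Alive g A B' S T i α → K ≤ r i α + cst (AE g A S) i + cst (AE g B' T) i := by
    intro i α h
    have hk := hK i α (h.mono (fun _ ha => ha) hsub)
    have hc := cst_mono hsub i
    omega
  have := hIC A B' S T E k hst hsat hload hV' hD' hneA hneB' (ℓ - 1) K r hL' hR' hK'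
  simp only [KWTree.depth_bob]
  omega

/-- ALICE AFFINE TEST on non-combinatorial rows: with budget `k ≥ 1` the `E`-consistent answer joins the
COMMON system for both players (`k − 1`; label sets, row sets, `AE`, `Alive`, `cst` all unchanged); with
`k = 0` the adversary collapses (`collapseE`). -/
theorem affine_stepAt_alice (hLU : PerRowLU g m q) {τ : Fin m → RowType}
    {s : (Fin m × Fin n → Bool) → Bool} {P Q : KWTree (Fin m × Fin n)} {S₀ : Finset (Fin m × Fin n)}
    {c : Bool} (hs : ∀ X, s X = Bool.xor c (parityOn S₀ X))
    (hτ : ∀ i ∈ touchedRows S₀, τ i ≠ RowType.combinatorial)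
    (hIP : InvAt g q (retag S₀ τ) P) (hIQ : InvAt g q (retag S₀ τ) Q) :
    InvAt g q τ (KWTree.alice s P Q) := by
  intro A B S T E k hst hsat hload hV hD hneA hneB ℓ K r hL hR hK
  cases k with
  | zero =>
    have h := collapseE hLU hst hsat (fun i => by have := hload i; omega) hV hL
    simp only [Nat.min_zero, Nat.add_zero]
    omega
  | succ k =>
    obtain ⟨X₀, hX₀⟩ := hsat
    obtain ⟨C, hIC, hCd, hrun⟩ := alice_childAt (s := s) hIP hIQ (Bool.xor c (parityOn S₀ X₀))
    set E' : AffSys m n := (S₀, parityOn S₀ X₀) :: E with hE'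
    have hst' : StateOK (retag S₀ τ) S T E' := hst.retag_cons hτ (parityOn S₀ X₀)
    have hsat' : ∃ X, Sat E' X := ⟨X₀, fun e he => by
      rcases List.mem_cons.1 he with rfl | he
      · rfl
      · exact hX₀ e he⟩
    have hload' : ∀ i, rowLoad E' i + k ≤ q := fun i => by
      have h1 := rowLoad_cons_le (S₀, parityOn S₀ X₀) E i
      have h2 := hload i
      rw [hE']
      omega
    have hV' : ValidOnE g C A B S T E' := by
      intro X hX Y hY
      rw [hE', XSetE_cons] at hX hY
      have h2 : parityOn S₀ X = parityOn S₀ X₀ := hX.2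
      have hsX : s X = Bool.xor c (parityOn S₀ X₀) := by rw [hs X, h2]
      have := hV X hX.1 Y hY.1
      rwa [hrun X Y hsX] at this
    have := hIC A B S T E' k hst' hsat' hload' hV' hD hneA hneB ℓ K r hL hR hK
    simp only [KWTree.depth_alice]
    omega

/-- BOB AFFINE TEST (the equation is read off Bob's side and imposed on both players alike). -/
theorem affine_stepAt_bob (hLU : PerRowLU g m q) {τ : Fin m → RowType}
    {s : (Fin m × Fin n → Bool) → Bool} {P Q : KWTree (Fin m × Fin n)} {S₀ : Finset (Fin m × Fin n)}
    {c : Bool} (hs : ∀ Y, s Y = Bool.xor c (parityOn S₀ Y))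
    (hτ : ∀ i ∈ touchedRows S₀, τ i ≠ RowType.combinatorial)
    (hIP : InvAt g q (retag S₀ τ) P) (hIQ : InvAt g q (retag S₀ τ) Q) :
    InvAt g q τ (KWTree.bob s P Q) := by
  intro A B S T E k hst hsat hload hV hD hneA hneB ℓ K r hL hR hK
  cases k with
  | zero =>
    have h := collapseE hLU hst hsat (fun i => by have := hload i; omega) hV hL
    simp only [Nat.min_zero, Nat.add_zero]
    omega
  | succ k =>
    obtain ⟨X₀, hX₀⟩ := hsat
    obtain ⟨C, hIC, hCd, hrun⟩ := bob_childAt (s := s) hIP hIQ (Bool.xor c (parityOn S₀ X₀))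
    set E' : AffSys m n := (S₀, parityOn S₀ X₀) :: E with hE'
    have hst' : StateOK (retag S₀ τ) S T E' := hst.retag_cons hτ (parityOn S₀ X₀)
    have hsat' : ∃ X, Sat E' X := ⟨X₀, fun e he => by
      rcases List.mem_cons.1 he with rfl | he
      · rfl
      · exact hX₀ e he⟩
    have hload' : ∀ i, rowLoad E' i + k ≤ q := fun i => by
      have h1 := rowLoad_cons_le (S₀, parityOn S₀ X₀) E i
      have h2 := hload i
      rw [hE']
      omega
    have hV' : ValidOnE g C A B S T E' := by
      intro X hX Y hY
      rw [hE', XSetE_cons] at hX hY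
      have h2 : parityOn S₀ Y = parityOn S₀ X₀ := hY.2
      have hsY : s Y = Bool.xor c (parityOn S₀ X₀) := by rw [hs Y, h2]
      have := hV X hX.1 Y hY.1
      rwa [hrun X Y hsY] at this
    have := hIC A B S T E' k hst' hsat' hload' hV' hD hneA hneB ℓ K r hL hR hK
    simp only [KWTree.depth_bob]
    omega

end Steps

end Summit.PneNP.PneNP.Theorems.KrwLrad
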